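import Summits.QuantumFields.BalabanUV.Beta.GAN24.OffDiagSandwich

/-!
# `BalabanUV.Beta.GAN24.OffDiagSandwichSum` — binder row G-an2-4 / (CONV-C), S-slot, road «S3-Taylor» (rows Vt / V / V0): THE OFF-DIAGONAL SANDWICH
# ENGINE, part 3 — PARTIAL SUMS AND SUMMABILITY OF THE CHANNELS BY NAME (so that the TWO channels of a (V-H) row, which share the outer site `y`
# in leaf-01's `e3VH_unit_split`, are added under ONE `Σ'_y` without `tsum_add`)

NOT IN PRINT; OUR BOOKKEEPING (G-an2-4 swarm leaf seat `b2b-balaban-gan24-formalise-leaf-14`, gen 18, holder of SHAPE row S3-V; parts 1–2 =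
`GAN24/OffDiagSandwichFlat` p206340 / `GAN24/OffDiagSandwich` p206398).  HONEST FRAMING (cell contract, verbatim): «discharging `BetaPertH` makes
Bałaban's UV stability UNCONDITIONAL — a real constructive-QFT result; it is NOT the continuum limit and NOT the Clay problem.»  HONEST DEPENDENCY
(verbatim): «continuum YM on T⁴ ⇐ BetaPertH ∧ nine spine estimates (0/9 proved); BetaPertH ⇐ (D1) ∧ (D4) ∧ CAP+tail; G-an2-4 gates asym, D1 and
NE2/3/4.»  [folklore] real bookkeeping over parts 1–2 BY NAME; cites nothing, mints no `def`, no `def … : Prop`.  Discharges NOTHING of row V, of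
«E3Shape»/«E3SupRate», of (hS, hSall); NOT BetaPertH, NOT continuum, NOT Clay.

## What is proved ([folklore]; `D` the dimension, `N ≥ 1`, `ι` a finite non-empty fibre-index type)
* `partial_and_summable` — under the hypotheses of `OffDiagSandwichFlat.abs_channel_le_of_finset_bound` (flat absolute sums `≤ Bd` over all finite
  site sets): `(∀ Y, Σ_{y∈Y} |integrand y| ≤ Bd) ∧ Summable integrand` (the quantitative content of that theorem, exported).
* **`sum_abs_channel_le_col`** / `summable_channel_col` (table of finite `y`-MASS) and **`sum_abs_channel_le_row`** / `summable_channel_row`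
  (finite `w`-MASS): the finite partial sums of `|integrand|` obey the bounds of `OffDiagSandwich.abs_channel_le_col` / `_row`
  (`(#ι)³ · Ca·CB·Ck·mT · (2r₁+1)^D · e^{κ((r₁+r₂)/N + 2D)} · Zl_D(κ/2) · e^{−(κ/2)(…)}`), and the integrand is summable.
-/

noncomputable section

open Finset
open scoped BigOperators
open Literature.MathematicalPhysics.QuantumFieldTheory
open Literature.MathematicalPhysics.QuantumFieldTheory.Balaban1983to89
open Literature.MathematicalPhysics.QuantumFieldTheory.Balaban1983to89.Beta
open B12Sec2to5 (l1 l1_nonneg)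
open ExpKernelCalculus (Zl)
open LatticeForm (quo)
open Summit.QuantumFields.BalabanUV.Beta.GAN24.OffDiagSandwichFlat (abs_integrand_le summand_nonneg)
open Summit.QuantumFields.BalabanUV.Beta.GAN24.OffDiagSandwich (reorder_col reorder_row core_bound)

namespace Summit.QuantumFields.BalabanUV.Beta.GAN24.OffDiagSandwichSum

variable {D : ℕ}

/-! ## §6 Partial sums of the `y`-integrand -/

section Table

variable {ι : Type*} [Fintype ι]
variable (A B K : ι → (Fin D → ℤ) → ℝ) (T : ι → (Fin D → ℤ) → (Fin D → ℤ) → (Fin D → ℤ) → ι → ι → ℝ) (c : ℝ)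
  {r₁ r₂ : ℕ}

/-- [folklore] **PARTIAL SUMS AND SUMMABILITY**: if the flat absolute sums over all finite `U, W, Y` are `≤ Bd`, then every finite partial sum of the
`y`-integrand's absolute value is `≤ Bd`, and the integrand is summable. -/
theorem partial_and_summable (hc : 0 ≤ c)
    (hTs : ∀ k u w y l l', T k u w y l l' ≠ 0 → l1 (w - u) ≤ r₁ ∧ l1 (y - u) ≤ r₂) {Bd : ℝ}
    (hBd : ∀ U W Y : Finset (Fin D → ℤ),
      ∑ y ∈ Y, ∑ l', ∑ w ∈ W, ∑ l, ∑ k, ∑ u ∈ U, |A l w| * (c * (|B k u| * |T k u w y l l'|)) * |K l' y| ≤ Bd) :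
    (∀ Y : Finset (Fin D → ℤ), ∑ y ∈ Y, |∑ l', (∑' w, ∑ l, A l w * ∑ k, c * ∑' u, B k u * T k u w y l l') * K l' y| ≤ Bd) ∧
      Summable fun y => ∑ l', (∑' w, ∑ l, A l w * ∑ k, c * ∑' u, B k u * T k u w y l l') * K l' y := by
  classical
  have hpart : ∀ Y : Finset (Fin D → ℤ),
      ∑ y ∈ Y, |∑ l', (∑' w, ∑ l, A l w * ∑ k, c * ∑' u, B k u * T k u w y l l') * K l' y| ≤ Bd := by
    intro Y
    set BW : (Fin D → ℤ) → Finset (Fin D → ℤ) :=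
      fun y => Fintype.piFinset (fun j => Finset.Icc (y j - (r₁ + r₂ : ℕ)) (y j + (r₁ + r₂ : ℕ))) with hBW
    set BU : (Fin D → ℤ) → Finset (Fin D → ℤ) := fun w => Fintype.piFinset (fun j => Finset.Icc (w j - r₁) (w j + r₁)) with hBU
    set W : Finset (Fin D → ℤ) := Y.biUnion BW with hWdef
    set U : Finset (Fin D → ℤ) := W.biUnion BU with hUdef
    calc ∑ y ∈ Y, |∑ l', (∑' w, ∑ l, A l w * ∑ k, c * ∑' u, B k u * T k u w y l l') * K l' y|
        ≤ ∑ y ∈ Y, ∑ l', ∑ w ∈ BW y, ∑ l, ∑ k, ∑ u ∈ BU w, |A l w| * (c * (|B k u| * |T k u w y l l'|)) * |K l' y| :=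
          Finset.sum_le_sum fun y _ => abs_integrand_le A B K T c hc hTs y
      _ ≤ ∑ y ∈ Y, ∑ l', ∑ w ∈ W, ∑ l, ∑ k, ∑ u ∈ U, |A l w| * (c * (|B k u| * |T k u w y l l'|)) * |K l' y| := by
          refine Finset.sum_le_sum fun y hy => Finset.sum_le_sum fun l' _ => ?_
          have hsubW : BW y ⊆ W := Finset.subset_biUnion_of_mem BW hy
          calc ∑ w ∈ BW y, ∑ l, ∑ k, ∑ u ∈ BU w, |A l w| * (c * (|B k u| * |T k u w y l l'|)) * |K l' y|
              ≤ ∑ w ∈ BW y, ∑ l, ∑ k, ∑ u ∈ U, |A l w| * (c * (|B k u| * |T k u w y l l'|)) * |K l' y| := by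
                refine Finset.sum_le_sum fun w hw => Finset.sum_le_sum fun l _ => Finset.sum_le_sum fun k _ => ?_
                have hwW : w ∈ W := hsubW hw
                exact Finset.sum_le_sum_of_subset_of_nonneg (Finset.subset_biUnion_of_mem BU hwW)
                  (fun u _ _ => summand_nonneg A B K T c hc k u w y l l')
            _ ≤ ∑ w ∈ W, ∑ l, ∑ k, ∑ u ∈ U, |A l w| * (c * (|B k u| * |T k u w y l l'|)) * |K l' y| :=
                Finset.sum_le_sum_of_subset_of_nonneg hsubW (fun w _ _ => Finset.sum_nonneg fun l _ =>
                  Finset.sum_nonneg fun k _ => Finset.sum_nonneg fun u _ => summand_nonneg A B K T c hc k u w y l l')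
      _ ≤ Bd := hBd U W Y
  exact ⟨hpart, (summable_of_sum_le (fun _ => abs_nonneg _) hpart).of_abs⟩

end Table

/-! ## §7 The two channel forms -/

section Sandwich

variable {ι : Type*} [Fintype ι] [Nonempty ι]

/-- [folklore] **PARTIAL SUMS, MASS ON THE OUTER SITE** : the partial sums of the integrand's absolute value obey `OffDiagSandwich.abs_channel_le_col`'s bound. -/
theorem sum_abs_channel_le_col (N : ℕ) [NeZero N] (A B K : ι → (Fin D → ℤ) → ℝ)
    (T : ι → (Fin D → ℤ) → (Fin D → ℤ) → (Fin D → ℤ) → ι → ι → ℝ) (c : ℝ) (hc : c = ((N : ℝ) ^ D)⁻¹)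
    {κ Ca CB Ck mT : ℝ} {r₁ r₂ : ℕ} (xA u' xK : Fin D → ℤ) (hκ : 0 < κ)
    (hA : ∀ l w, |A l w| ≤ Ca * Real.exp (-κ * l1 (quo N w - xA)))
    (hB : ∀ k u, |B k u| ≤ CB * Real.exp (-κ * l1 (quo N u - u')))
    (hK : ∀ l' y, |K l' y| ≤ Ck * Real.exp (-κ * l1 (quo N y - xK)))
    (hTm : ∀ k u w l l' (Y : Finset (Fin D → ℤ)), ∑ y ∈ Y, |T k u w y l l'| ≤ mT)
    (hTs : ∀ k u w y l l', T k u w y l l' ≠ 0 → l1 (w - u) ≤ r₁ ∧ l1 (y - u) ≤ r₂) (Y : Finset (Fin D → ℤ)) :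
    ∑ y ∈ Y, |∑ l', (∑' w, ∑ l, A l w * ∑ k, c * ∑' u, B k u * T k u w y l l') * K l' y| ≤
      (Fintype.card ι : ℝ) ^ 3 * (Ca * CB * Ck * mT) * (2 * r₁ + 1 : ℝ) ^ D *
        Real.exp (κ * (((r₁ : ℝ) + r₂) / N + 2 * D)) *
          (Zl D (κ / 2) * Real.exp (-(κ / 2) * (l1 (xA - u') + l1 (xK - u')))) := by
  subst hc
  refine (partial_and_summable A B K T _ (by positivity) hTs (fun U W Y => ?_)).1 Y
  exact (reorder_col U W Y _).trans_le (core_bound N A B K T xA u' xK hκ hA hB hK hTm hTs U W Y)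

/-- [folklore] **SUMMABILITY, MASS ON THE OUTER SITE**. -/
theorem summable_channel_col (N : ℕ) [NeZero N] (A B K : ι → (Fin D → ℤ) → ℝ)
    (T : ι → (Fin D → ℤ) → (Fin D → ℤ) → (Fin D → ℤ) → ι → ι → ℝ) (c : ℝ) (hc : c = ((N : ℝ) ^ D)⁻¹)
    {κ Ca CB Ck mT : ℝ} {r₁ r₂ : ℕ} (xA u' xK : Fin D → ℤ) (hκ : 0 < κ)
    (hA : ∀ l w, |A l w| ≤ Ca * Real.exp (-κ * l1 (quo N w - xA)))
    (hB : ∀ k u, |B k u| ≤ CB * Real.exp (-κ * l1 (quo N u - u')))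
    (hK : ∀ l' y, |K l' y| ≤ Ck * Real.exp (-κ * l1 (quo N y - xK)))
    (hTm : ∀ k u w l l' (Y : Finset (Fin D → ℤ)), ∑ y ∈ Y, |T k u w y l l'| ≤ mT)
    (hTs : ∀ k u w y l l', T k u w y l l' ≠ 0 → l1 (w - u) ≤ r₁ ∧ l1 (y - u) ≤ r₂) :
    Summable fun y => ∑ l', (∑' w, ∑ l, A l w * ∑ k, c * ∑' u, B k u * T k u w y l l') * K l' y :=
  (summable_of_sum_le (fun _ => abs_nonneg _)
    (sum_abs_channel_le_col N A B K T c hc xA u' xK hκ hA hB hK hTm hTs)).of_abs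

/-- [folklore] **PARTIAL SUMS, MASS ON THE INNER SITE**. -/
theorem sum_abs_channel_le_row (N : ℕ) [NeZero N] (A B K : ι → (Fin D → ℤ) → ℝ)
    (T : ι → (Fin D → ℤ) → (Fin D → ℤ) → (Fin D → ℤ) → ι → ι → ℝ) (c : ℝ) (hc : c = ((N : ℝ) ^ D)⁻¹)
    {κ Ca CB Ck mT : ℝ} {r₁ r₂ : ℕ} (xA u' xK : Fin D → ℤ) (hκ : 0 < κ)
    (hA : ∀ l w, |A l w| ≤ Ca * Real.exp (-κ * l1 (quo N w - xA)))
    (hB : ∀ k u, |B k u| ≤ CB * Real.exp (-κ * l1 (quo N u - u')))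
    (hK : ∀ l' y, |K l' y| ≤ Ck * Real.exp (-κ * l1 (quo N y - xK)))
    (hTm : ∀ k u y l l' (W : Finset (Fin D → ℤ)), ∑ w ∈ W, |T k u w y l l'| ≤ mT)
    (hTs : ∀ k u w y l l', T k u w y l l' ≠ 0 → l1 (w - u) ≤ r₂ ∧ l1 (y - u) ≤ r₁) (Y : Finset (Fin D → ℤ)) :
    ∑ y ∈ Y, |∑ l', (∑' w, ∑ l, A l w * ∑ k, c * ∑' u, B k u * T k u w y l l') * K l' y| ≤
      (Fintype.card ι : ℝ) ^ 3 * (Ck * CB * Ca * mT) * (2 * r₁ + 1 : ℝ) ^ D *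
        Real.exp (κ * (((r₁ : ℝ) + r₂) / N + 2 * D)) *
          (Zl D (κ / 2) * Real.exp (-(κ / 2) * (l1 (xK - u') + l1 (xA - u')))) := by
  subst hc
  refine (partial_and_summable A B K T _ (by positivity) hTs (fun U W Y => ?_)).1 Y
  have hswap : ∑ y ∈ Y, ∑ l', ∑ w ∈ W, ∑ l, ∑ k, ∑ u ∈ U,
      |A l w| * (((N : ℝ) ^ D)⁻¹ * (|B k u| * |T k u w y l l'|)) * |K l' y| =
      ∑ y ∈ Y, ∑ l', ∑ w ∈ W, ∑ l, ∑ k, ∑ u ∈ U,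
        |K l' y| * (((N : ℝ) ^ D)⁻¹ * (|B k u| * |T k u w y l l'|)) * |A l w| :=
    Finset.sum_congr rfl fun _ _ => Finset.sum_congr rfl fun _ _ => Finset.sum_congr rfl fun _ _ =>
      Finset.sum_congr rfl fun _ _ => Finset.sum_congr rfl fun _ _ => Finset.sum_congr rfl fun _ _ => by ring
  rw [hswap]
  exact (reorder_row U W Y fun l' l k u w y => |K l' y| * (((N : ℝ) ^ D)⁻¹ * (|B k u| * |T k u w y l l'|)) * |A l w|).trans_le
    (core_bound N K B A (fun k u p q L L' => T k u q p L' L) xK u' xA hκ hK hB hA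
      (fun k u p L L' Q => hTm k u p L' L Q) (fun k u p q L L' h => (hTs k u q p L' L h).symm) U Y W)

/-- [folklore] **SUMMABILITY, MASS ON THE INNER SITE**. -/
theorem summable_channel_row (N : ℕ) [NeZero N] (A B K : ι → (Fin D → ℤ) → ℝ)
    (T : ι → (Fin D → ℤ) → (Fin D → ℤ) → (Fin D → ℤ) → ι → ι → ℝ) (c : ℝ) (hc : c = ((N : ℝ) ^ D)⁻¹)
    {κ Ca CB Ck mT : ℝ} {r₁ r₂ : ℕ} (xA u' xK : Fin D → ℤ) (hκ : 0 < κ)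
    (hA : ∀ l w, |A l w| ≤ Ca * Real.exp (-κ * l1 (quo N w - xA)))
    (hB : ∀ k u, |B k u| ≤ CB * Real.exp (-κ * l1 (quo N u - u')))
    (hK : ∀ l' y, |K l' y| ≤ Ck * Real.exp (-κ * l1 (quo N y - xK)))
    (hTm : ∀ k u y l l' (W : Finset (Fin D → ℤ)), ∑ w ∈ W, |T k u w y l l'| ≤ mT)
    (hTs : ∀ k u w y l l', T k u w y l l' ≠ 0 → l1 (w - u) ≤ r₂ ∧ l1 (y - u) ≤ r₁) :
    Summable fun y => ∑ l', (∑' w, ∑ l, A l w * ∑ k, c * ∑' u, B k u * T k u w y l l') * K l' y :=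
  (summable_of_sum_le (fun _ => abs_nonneg _)
    (sum_abs_channel_le_row N A B K T c hc xA u' xK hκ hA hB hK hTm hTs)).of_abs

end Sandwich

end Summit.QuantumFields.BalabanUV.Beta.GAN24.OffDiagSandwichSum

end
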